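import Mathlib.Analysis.Calculus.MeanValue
import Literature.Analysis.FunctionSpaces.PeriodicPrimitive
import HarnessLib

/-!
# Smooth periodic primitives, mean-zero normalisation and uniqueness

Analysis/FunctionSpaces support file, continuing `PeriodicPrimitive.lean` (averaging along the
orbits of a circle action; McDuff–Salamon 2017, §5.5; McLean 2012, proof of Lemma 5.17).  The
solution `H (p, t) = ∫₀ᵗ G - t·A(p)` of `∂ₜ H = G - A` constructed there is normalised by
`H (p, 0) = 0`, which depends on the origin of the angle; when the circle orbits are read in
several charts (a disc bundle with `U(1)`-valued transition functions rotates the angle), the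
intrinsic normalisation is **mean zero over the orbit**.  This file provides it:

* `contDiff_tAverage` — the orbit average `p ↦ ∫₀ᵀ H (p, s) ds` of a jointly smooth `H` is smooth;
* `exists_periodicPrimitive_meanZero` — a `C^∞`, `T`-periodic `H₀` with `∂ₜ H₀ = G - A` AND
  `∫₀ᵀ H₀ (p, s) ds = 0`;
* `eq_of_deriv_eq_of_integral_eq` — **uniqueness**: two differentiable functions on `ℝ` with the
  same derivative and the same integral over `[0, T]` (`T ≠ 0`) coincide; hence the mean-zero
  solution along an orbit does not depend on the chart used to write it.

Everything is proved; no definitions, no named facts (D-0026).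

## References

* D. McDuff, D. Salamon, *Introduction to Symplectic Topology*, 3rd ed. (2017), §5.5.
  [McDuffSalamon2017]
* M. McLean, *The growth rate of symplectic homology and affine varieties*, Geom. Funct. Anal. 22
  (2012), proof of Lemma 5.17. [Mclean2012]
-/

noncomputable section

open MeasureTheory Set Filter Topology intervalIntegral
open scoped ContDiff

namespace Literature.Analysis.FunctionSpaces

variable {P : Type*} [NormedAddCommGroup P] [NormedSpace ℝ P] [FiniteDimensional ℝ P]

/-- **The orbit average of a jointly smooth function is smooth in the parameter**:
`p ↦ ∫₀ᵀ H (p, s) ds` is `C^∞` for `H : P × ℝ → ℝ` of class `C^∞`. [folklore] -/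
theorem contDiff_tAverage {H : P × ℝ → ℝ} (hH : ContDiff ℝ ∞ H) (T : ℝ) :
    ContDiff ℝ ∞ fun p : P ↦ ∫ s in (0 : ℝ)..T, H (p, s) := by
  have hH' : ContDiff ℝ ∞ fun y : ℝ × P ↦ H (y.2, y.1) :=
    hH.comp (contDiff_snd.prodMk contDiff_fst)
  exact contDiff_parametric_intervalIntegral (H := fun y : ℝ × P ↦ H (y.2, y.1)) hH' 0 T

/-- **Mean-zero smooth periodic primitive** (averaging over a circle action, intrinsic
normalisation): for `G : ℝ × P → ℝ` of class `C^∞`, `T`-periodic in the first variable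
(`T ≠ 0`), there is `H₀ : P × ℝ → ℝ` of class `C^∞`, `T`-periodic in `t`, with
`∂ₜ H₀ (p, t) = G (t, p) - T⁻¹ ∫₀ᵀ G (s, p) ds` and `∫₀ᵀ H₀ (p, s) ds = 0` for every `p`.
[cite: McDuffSalamon2017, §5.5 (averaging over a circle action)] -/
theorem exists_periodicPrimitive_meanZero {G : ℝ × P → ℝ} (hG : ContDiff ℝ ∞ G) {T : ℝ}
    (hT : T ≠ 0) (hper : ∀ s p, G (s + T, p) = G (s, p)) :
    ∃ H₀ : P × ℝ → ℝ, ContDiff ℝ ∞ H₀ ∧ (∀ p t, H₀ (p, t + T) = H₀ (p, t)) ∧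
      (∀ p t, HasDerivAt (fun t ↦ H₀ (p, t)) (G (t, p) - T⁻¹ * ∫ s in (0 : ℝ)..T, G (s, p)) t) ∧
      ∀ p, ∫ s in (0 : ℝ)..T, H₀ (p, s) = 0 := by
  obtain ⟨H, hH, hHper, hHd⟩ := exists_periodicPrimitive hG hT hper
  refine ⟨fun x ↦ H x - T⁻¹ * ∫ s in (0 : ℝ)..T, H (x.1, s), ?_, ?_, ?_, ?_⟩
  · exact hH.sub (contDiff_const.mul ((contDiff_tAverage hH T).comp contDiff_fst))
  · intro p t
    simp only [hHper p t]
  · intro p t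
    simpa using (hHd p t).sub_const (T⁻¹ * ∫ s in (0 : ℝ)..T, H (p, s))
  · intro p
    have hc : Continuous fun s : ℝ ↦ H (p, s) :=
      hH.continuous.comp (continuous_const.prodMk continuous_id)
    show ∫ s in (0 : ℝ)..T, (H (p, s) - T⁻¹ * ∫ s in (0 : ℝ)..T, H (p, s)) = 0
    rw [intervalIntegral.integral_sub (hc.intervalIntegrable _ _) intervalIntegrable_const,
      intervalIntegral.integral_const, sub_zero, smul_eq_mul]
    field_simp
    ring

omit [NormedSpace ℝ P] [FiniteDimensional ℝ P] in
/-- **Uniqueness of the mean-zero primitive**: two differentiable real functions with the same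
derivative everywhere and the same integral over `[0, T]`, `T ≠ 0`, are equal (their difference
is a constant with integral `cT = 0`).  Hence the mean-zero solution of `∂ₜ H = G - A` along a
circle orbit does not depend on the origin of the angle. [folklore] -/
theorem eq_of_deriv_eq_of_integral_eq {F₁ F₂ : ℝ → ℝ} (h₁ : Differentiable ℝ F₁)
    (h₂ : Differentiable ℝ F₂) (hd : ∀ t, deriv F₁ t = deriv F₂ t) {T : ℝ} (hT : T ≠ 0)
    (hint : ∫ s in (0 : ℝ)..T, F₁ s = ∫ s in (0 : ℝ)..T, F₂ s) : F₁ = F₂ := by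
  -- the difference is constant
  have hD : Differentiable ℝ (F₁ - F₂) := h₁.sub h₂
  have hD' : ∀ t, deriv (F₁ - F₂) t = 0 := fun t ↦ by
    rw [deriv_sub (h₁ t) (h₂ t), hd t, sub_self]
  have hconst : ∀ t, (F₁ - F₂) t = (F₁ - F₂) 0 := fun t ↦ is_const_of_deriv_eq_zero hD hD' t 0
  set c : ℝ := (F₁ - F₂) 0 with hc
  -- its integral over `[0, T]` is `cT = 0`
  have hI : ∫ s in (0 : ℝ)..T, (F₁ - F₂) s = c * T := by
    have : (fun s ↦ (F₁ - F₂) s) = fun _ ↦ c := funext hconst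
    rw [this, intervalIntegral.integral_const, sub_zero, smul_eq_mul, mul_comm]
  have hI' : ∫ s in (0 : ℝ)..T, (F₁ - F₂) s = 0 := by
    rw [show (fun s ↦ (F₁ - F₂) s) = fun s ↦ F₁ s - F₂ s from rfl,
      intervalIntegral.integral_sub (h₁.continuous.intervalIntegrable _ _)
        (h₂.continuous.intervalIntegrable _ _), hint, sub_self]
  have hc0 : c = 0 := by
    have h := hI.symm.trans hI'
    rcases mul_eq_zero.1 h with h | h
    · exact h
    · exact absurd h hT
  funext t
  have := hconst t
  rw [hc0, Pi.sub_apply, sub_eq_zero] at this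
  exact this

end Literature.Analysis.FunctionSpaces
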